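import Summits.Ventures.CertifiedManyBodySolver.Downfold.EmeryBoxesBi2223OPMoreePPThermalCapRetiltMarkovBoxp1
import Summits.Ventures.CertifiedManyBodySolver.Downfold.EmeryBoxesBi2223OPMoreePPThermalFloorAtlasWord
import Summits.Ventures.CertifiedManyBodySolver.Downfold.EmeryThermalAtomicFloor
import HarnessLib

/-!
# HIGH-TEMPERATURE-CLOSING `T > 0` WINDOW on Bi2Sr2Ca2Cu3O10 (M307 Bi-2223) OP plane Cu-OP — U-SLICE «Morée 2022 PP cGW-SIC Bi2212 δ 0. — `emeryBoxBi2223OPMoreePP` (router/EMERY-FLOOR-ORDERS row 84): the ATOMIC-LIMIT floor (full entropy) ∨ the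
# family floor, against the re-tilted cap — both sides meet at `6 log 2` as β → 0

Venture CertifiedManyBodySolver, cell `pub/hubbard-downfold` (S1 = ROUTER) × crew hubbard-fast S2 (ii) × (iv) «T > 0 × multi-band» (D-0096 (ii)); seat hubbard-downfold-mod-4
(S1/S2 Emery seam, g17). Namespace `Summit.Ventures.CertifiedManyBodySolver.Downfold`. DOOR: `EmeryThermalAtomicFloor` (`holdsOn_emeryCellPressureAtomicFloor`: Peierls on the
whole occupation basis of the `Cu₄O₈` block, site-wise factorisation; the one-site function is the tree's `atomicPartitionFnReal β U μ`). INPUTS BY NAME: the family floor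
`emeryBoxBi2223OPMoreePP_pressureFloorFam_m107o10` (`EmeryBoxesBi2223OPMoreePPThermalFloorAtlasWord`; C = (-161.174257, -163.110773)), the cap `emeryBoxBi2223OPMoreePP_pressureCap_m107o10_retilt` (`EmeryBoxesBi2223OPMoreePPThermalCapRetiltMarkovBoxp1`; `6 log 2 + 45.4035·β`; flat word 48.6035).
ATOMIC DATA: Cu at `μ_d = −(εp + Δ_hi) = 44/5`, `U_d,hi = 9`; O at `μ_p = −εp = 107/10`, `U_p,hi = 117/20` ⇒ classical slope 39.9000·β (family slope 40.7777; cap 45.4035).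
RESULT: **`emeryBoxBi2223OPMoreePP_pressureWindowHighT_m107o10`**: `max(atomic, family) ≤ P_cell ≤ 6 log 2 + 45.4035·β` on the whole box, every β ≥ 0; width → 0 as β → 0 (both sides `6 log 2`,
`emeryBoxBi2223OPMoreePP_pressure_beta_zero_m107o10`); crossover β* ≈ 1.158 (T* ≈ 10020 K) below which the atomic floor is the better floor [float].

Everything PROVED (0 sorry); no definition. HONEST FRAMING: CERTIFIED inequalities on a SCREENING/EXTRAPOLATED-grade object; the atomic floor ignores hopping (its slope sits
0.8777 below the family floor's), so at physical temperatures (β ≈ 20–40 eV⁻¹) the family floor still decides and thermal scales are NOT resolved there; what is new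
is the correct INFINITE-TEMPERATURE closure of the window and a certified high-T regime (β ≲ β*) with width `≈ 5.5035·β`; grand-canonical at the stated level; no phase word;
no router number moves. WHAT-THIS-IS-NOT: a new certificate (pure algebra on landed objects; zero kit).
-/

noncomputable section

namespace Summit.Ventures.CertifiedManyBodySolver.Downfold

open NonemptyInterval Matrix Finset Literature.Probability.LatticeModels
open Literature.MathematicalPhysics.QuantumLattice Literature.Computation.Certificates
open Summit.Ventures.CertifiedManyBodySolver.Certificates OccupationCode ClusterLowerBound
open scoped BigOperators ComplexOrder

/-! ## §1 The atomic-limit floor on the box at εp = -107/10 -/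

/-- **ATOMIC-LIMIT `T > 0` FLOOR** on the whole `emeryBoxBi2223OPMoreePP`, cuprate signs, level εp = -107/10 (chemical potential 107/10 eV), EVERY β ≥ 0:
`log z₀(β; U_d = 9, μ_d = 44/5) + 2·log z₀(β; U_p = 117/20, μ_p = 107/10) ≤ P_cell` with `z₀(β; U, μ) = 1 + 2e^{βμ} + e^{−β(U−2μ)}` (`atomicPartitionFnReal`; Cu at the
box's upper level `εp + Δ_hi = -44/5` and `U_d,hi`, O at `εp` and `U_p,hi`). Value `6 log 2` at β = 0; slope `39.9000·β` as β → ∞ (classical minimum, no hopping).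
[cite: Ruelle1969, §2.5–2.6] [cite: Ueltschi1999, §3] -/
theorem emeryBoxBi2223OPMoreePP_pressureAtomicFloor_m107o10 {β : ℝ} (hβ : 0 ≤ β) :
    HoldsOn (fun p : EmeryCoord → ℝ => Real.log (atomicPartitionFnReal β (9 : ℝ) (44/5 : ℝ)) + 2 * Real.log (atomicPartitionFnReal β (117/20 : ℝ) (107/10 : ℝ)) ≤ emeryCellPressure β (emeryLine cuprateSigns (emeryLineCoords (((-107/10 : ℚ)) : ℝ) p))) emeryBoxBi2223OPMoreePP := by
  intro p hp
  have h := holdsOn_emeryCellPressureAtomicFloor (E := emeryBoxBi2223OPMoreePP) (eA := bi2223OPMoreePPEmery_tpd) (eB := bi2223OPMoreePPEmery_tpp) (eD := bi2223OPMoreePPEmery_Delta) (eUd := bi2223OPMoreePPEmery_Udd) (eUp := bi2223OPMoreePPEmery_Upp) (-107/10) (by simp [emeryBoxBi2223OPMoreePP, emeryBoxBi2223OPMoreePPSrc, Function.update]) (by simp [emeryBoxBi2223OPMoreePP, emeryBoxBi2223OPMoreePPSrc, Function.update]) (Function.update_self _ _ _) (by simp [emeryBoxBi2223OPMoreePP,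 emeryBoxBi2223OPMoreePPSrc, Function.update]) (by simp [emeryBoxBi2223OPMoreePP, emeryBoxBi2223OPMoreePPSrc, Function.update]) cuprateSigns hβ p hp
  simp only [bi2223OPMoreePPEmery_Delta, bi2223OPMoreePPEmery_Udd, bi2223OPMoreePPEmery_Upp, Entry.encl_ofEnds_snd] at h
  push_cast at h
  norm_num at h ⊢
  exact h

/-! ## §2 The best floor and the HIGH-TEMPERATURE-CLOSING window -/

/-- **BEST `T > 0` FLOOR = max(atomic, family)** on the whole box at εp = -107/10, every β ≥ 0: the atomic floor (full entropy, slope 39.9000) wins for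
β < β* ≈ 1.158 (T > 10020 K), the family floor `emeryBoxBi2223OPMoreePP_pressureFloorFam_m107o10` (slope 40.7777, entropy ¼·log 2) for β > β*. [cite: Ruelle1969, §2.5–2.6] [cite: Israel1979, Lemma II.3.1] -/
theorem emeryBoxBi2223OPMoreePP_pressureFloorBest_m107o10 {β : ℝ} (hβ : 0 ≤ β) :
    HoldsOn (fun p : EmeryCoord → ℝ => max (Real.log (atomicPartitionFnReal β (9 : ℝ) (44/5 : ℝ)) + 2 * Real.log (atomicPartitionFnReal β (117/20 : ℝ) (107/10 : ℝ))) (Real.log (Real.exp (-(β * (-161174257/1000000 : ℝ))) + Real.exp (-(β * (-163110773/1000000 : ℝ)))) / 4) ≤ emeryCellPressure β (emeryLine cuprateSigns (emeryLineCoords (((-107/10 : ℚ)) : ℝ) p))) emeryBoxBi2223OPMoreePP :=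
  fun p hp => max_le (emeryBoxBi2223OPMoreePP_pressureAtomicFloor_m107o10 hβ p hp) (emeryBoxBi2223OPMoreePP_pressureFloorFam_m107o10 hβ p hp)

/-- **THE HIGH-TEMPERATURE-CLOSING TWO-SIDED `T > 0` WINDOW** (hypothesis-free on both sides) on the whole `emeryBoxBi2223OPMoreePP`, level εp = -107/10, EVERY β ≥ 0:
`max(atomic, family) ≤ P_cell ≤ 6 log 2 + β·90807/2000` (cap = `emeryBoxBi2223OPMoreePP_pressureCap_m107o10_retilt`, hubbard-box-p1 re-tilted). BOTH SIDES EQUAL `6 log 2` AT β = 0; the width is `O(β)` for small β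
(slope gap 5.5035 against the atomic floor, 4.6258 against the family floor). Table [float; `T = 11604.5/β` K]:
| β (1/eV) | T (K) | atomic floor | family floor | best floor | cap | width |
|---|---|---|---|---|---|---|
| 0.01 | 1160450 | 4.4130 | 0.5787 | 4.4130 | 4.6129 | 0.1999 |
| 0.1 | 116045 | 6.9984 | 4.2280 | 6.9984 | 8.6992 | 1.7008 |
| 0.5 | 23209 | 21.3472 | 20.4693 | 21.3472 | 26.8606 | 5.5135 |
| 1 | 11604 | 40.9674 | 40.8114 | 40.9674 | 49.5624 | 8.5950 |
| 2 | 5802 | 80.7824 | 81.5605 | 81.5605 | 94.9659 | 13.4054 |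
| 5 | 2321 | 200.3620 | 203.8885 | 203.8885 | 231.1764 | 27.2879 |
| 10 | 1160 | 399.7586 | 407.7769 | 407.7769 | 458.1939 | 50.4170 |
| 20 | 580 | 798.7023 | 815.5539 | 815.5539 | 912.2289 | 96.6750 |
| 40 | 290 | 1596.6933 | 1631.1077 | 1631.1077 | 1820.2989 | 189.1912 |
[cite: Israel1979, Thm. I.2.4] [cite: Ruelle1969, §2.5–2.6] [cite: Ueltschi1999, §3] -/
theorem emeryBoxBi2223OPMoreePP_pressureWindowHighT_m107o10 {β : ℝ} (hβ : 0 ≤ β) :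
    HoldsOn (fun p : EmeryCoord → ℝ =>
      max (Real.log (atomicPartitionFnReal β (9 : ℝ) (44/5 : ℝ)) + 2 * Real.log (atomicPartitionFnReal β (117/20 : ℝ) (107/10 : ℝ))) (Real.log (Real.exp (-(β * (-161174257/1000000 : ℝ))) + Real.exp (-(β * (-163110773/1000000 : ℝ)))) / 4) ≤ emeryCellPressure β (emeryLine cuprateSigns (emeryLineCoords (((-107/10 : ℚ)) : ℝ) p)) ∧
      emeryCellPressure β (emeryLine cuprateSigns (emeryLineCoords (((-107/10 : ℚ)) : ℝ) p)) ≤ 6 * Real.log 2 + β * (90807/2000 : ℝ)) emeryBoxBi2223OPMoreePP :=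
  fun p hp => ⟨emeryBoxBi2223OPMoreePP_pressureFloorBest_m107o10 hβ p hp, by simpa using emeryBoxBi2223OPMoreePP_pressureCap_m107o10_retilt hβ p hp⟩

/-- **At β = 0 the window is a point**: `P_cell(0, ·) = 6 log 2` on the whole box (floor and cap coincide). [cite: Ueltschi1999, §3] -/
theorem emeryBoxBi2223OPMoreePP_pressure_beta_zero_m107o10 :
    HoldsOn (fun p : EmeryCoord → ℝ => emeryCellPressure 0 (emeryLine cuprateSigns (emeryLineCoords (((-107/10 : ℚ)) : ℝ) p)) = 6 * Real.log 2) emeryBoxBi2223OPMoreePP := by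
  intro p hp
  have h := emeryBoxBi2223OPMoreePP_pressureWindowHighT_m107o10 le_rfl p hp
  rw [atomicPartitionFnReal_beta_zero, atomicPartitionFnReal_beta_zero, show (4 : ℝ) = 2 ^ 2 by norm_num, Real.log_pow] at h
  simp only [Nat.cast_ofNat, zero_mul, add_zero] at h
  have h1 := (le_max_left _ _).trans h.1
  linarith [h.2]

end Summit.Ventures.CertifiedManyBodySolver.Downfold

end
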